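import Literature.NumberTheory.EllipticCurves.SharpFlatPAdicLFunctionCoeffField
import Literature.NumberTheory.GaloisRepresentations.AbsGaloisGroup
import Summits.BirchSwinnertonDyer.BirchSwinnertonDyer.Theorems.ResidualThetaTransportAtTwoResidualSignedLambdaLowerCMAtTwoStationRCoeffEmbeddings
import Summits.BirchSwinnertonDyer.BirchSwinnertonDyer.Theorems.ThetaPartnerAtTwoSignedKatoUpToAtTwoFrameRigidity
import HarnessLib

/-!
# Child A of KZ_g at the one-pair pins (crux RSL_g `ResidualSignedLambdaLowerCMAtTwo`, stmt-BirchSwinnertonDyer-22608, line `onepair`) —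
# file A1: FROBENIUS COORDINATES of `ℚ_p`-linear functionals on `𝒪 = padicCoeffIntegers S`, common `p`-power scalings, and the
# Galois-sum bookkeeping of the child-A port

Route `ResidualThetaTransportAtTwo` (RTT); width seat `bsd-wall-tp2-p2x-w3` g19 (helper file, `--supports stmt-BirchSwinnertonDyer-22608`, closes
nothing). PURE ALGEBRA, THEOREMS ONLY (no definition, no instance, no notation, no `sorry`). Context: the PRINT stub `stub_kzgChildA` of
`Cruxes/ResidualSignedLambdaLowerCMAtTwo/Lines/onepair.lean` (child A `KatoZetaValuedClassCMAtTwo`: `∀ F : π.KatoFrame, ∃ z c′ w q μt,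
π.KatoValuedClass …`) became MIXED when the named fact `Kato2004.exists_zetaElement_newform_tatePairing_values_two` (Kato 2004 Thm. 12.5 (1) at
`p = 2` with `𝒪_λ`-coefficients, file `Kato2004/ZetaElementNewformTatePairingValuesTwo.lean`) landed: the fact outputs Kato's class `z`, `ℚ₂`-LINEAR
comparison functionals `ℓ_i : ℚ̄₂ → ℚ₂` separating `𝒪`, and RATIONAL values `Σ_k f_{N,k} ⊗ u_{N,k}`; the consumer's predicate `KatoBKCoord` /
`KatoValCoord` / `KatoTrivCoord` wants coordinates `c′_i ∈ 𝒪` of the functionals in the Frobenius datum `(t₀, bO, bO′)` of the pins and values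
`w_{N,j} ∈ ℚ̄₂` recombined along `bO`. This file is step (P2) «COORDINATES» of the route pen's port recipe (bsd-wall STATUS 2026-08-29T14:49:11Z):

* `exists_pow_forall_norm_mul_le_one` / `exists_pow_forall_mul_mem_padicCoeffIntegers` — ONE `p`-power clears a finite family of `p`-adic numbers
  into `ℤ_p`, resp. of elements of `ℚ_p(S)` into `𝒪` (`𝒪[1/p] = ℚ_p(S)`);
* `coe_eq_sum_t₀_mul_bO` / `coe_t₀_mul_eq_sum` — the dual-basis expansion `φ = Σ_j t₀(φ bO′_j) bO_j` read in `ℚ̄_p`, and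
  `t₀(c φ) = Σ_j t₀(φ bO′_j) t₀(c bO_j)` (`ℤ_p`-linearity of `t₀`);
* `exists_frobeniusCoords` — **every finite family of `ℚ_p`-linear functionals `ℓ_i` on `ℚ̄_p` is, on `𝒪` and after ONE scaling `p^s`, of the
  form `a ↦ t₀(c′_i a)` with `c′_i ∈ 𝒪`** (`c′_i = Σ_j p^s ℓ_i(bO_j) bO′_j`), and `injective_t₀Coords_of_injective` — the coordinates separate `𝒪`
  when the functionals do (the consumer's `CoordNondeg`);
* `sum_smul_mul_sum_algebraMap_mul` — `Σ_b τ_b • (x · Σ_k d_k y_k) = Σ_k d_k · Σ_b τ_b • (x y_k)` for `d_k ∈ ℚ_p` (the Galois group of `ℚ_p`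
  fixes `ℚ_p`; `SignedKatoOffTwo.FrameChange.gal_smul_algebraMap`).

References: [Lang2002] Ch. VI §5 Cor. 5.3 (dual bases for a non-degenerate trace form); [Kato2004Asterisque] Thm. 12.5 (1) (p. 221) (where the
coordinates are consumed); [EmertonPollackWeston2006] §3.1 (`𝒪` the ring of integers of `K = ℚ_p(S)`). BSD is not proved by anything here;
22608 / 24105 stay OPEN / HOLD.
-/

set_option autoImplicit false
-- D-0017: single-problem summit, so `Summit.BirchSwinnertonDyer.BirchSwinnertonDyer.…` repeats a namespace BY DESIGN.
set_option linter.dupNamespace false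

noncomputable section

open scoped Classical

namespace Summit.BirchSwinnertonDyer.BirchSwinnertonDyer.Theorems.ThetaTransport.ChildA

open Literature.NumberTheory.EllipticCurves

variable {p : ℕ} [Fact p.Prime] (S : Set (PadicAlgCl p))

/-! ## §1 One `p`-power clears a finite family -/

/-- `‖p^s x‖ ≤ 1` for one `s` and a finite family `x_i ∈ ℚ_p`. [folklore] -/
theorem exists_pow_forall_norm_mul_le_one {ι : Type*} [Finite ι] (x : ι → ℚ_[p]) :
    ∃ s : ℕ, ∀ i, ‖(p : ℚ_[p]) ^ s * x i‖ ≤ 1 := by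
  have hp1 : (1 : ℝ) < p := by exact_mod_cast (Fact.out : p.Prime).one_lt
  have hp0 : (0 : ℝ) < p := lt_trans zero_lt_one hp1
  have hnp : ‖(p : ℚ_[p])‖ = (p : ℝ)⁻¹ := Padic.norm_p
  -- one exponent per index
  have hone : ∀ i, ∃ s : ℕ, ∀ s', s ≤ s' → ‖(p : ℚ_[p]) ^ s' * x i‖ ≤ 1 := by
    intro i
    obtain ⟨s, hs⟩ := pow_unbounded_of_one_lt ‖x i‖ hp1
    refine ⟨s, fun s' hs' ↦ ?_⟩
    rw [norm_mul, norm_pow, hnp, inv_pow, inv_mul_le_iff₀ (pow_pos hp0 s'), mul_one]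
    exact hs.le.trans (pow_le_pow_right₀ hp1.le hs')
  choose s hs using hone
  haveI := Fintype.ofFinite ι
  exact ⟨Finset.univ.sup s, fun i ↦ hs i _ (Finset.le_sup (Finset.mem_univ i))⟩

/-- `p^t x_i ∈ 𝒪` for one `t` and a finite family `x_i ∈ ℚ_p(S)` (`𝒪[1/p] = ℚ_p(S)`), read in `ℚ̄_p`. [cite: EmertonPollackWeston2006, §3.1 (p. 17)] -/
theorem exists_pow_forall_mul_mem_padicCoeffIntegers {ι : Type*} [Finite ι] (x : ι → padicCoeffField S) :
    ∃ t : ℕ, ∀ i, algebraMap ℚ_[p] (PadicAlgCl p) ((p : ℚ_[p]) ^ t) * (x i : PadicAlgCl p) ∈ padicCoeffIntegers S := by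
  have hone : ∀ i, ∃ t : ℕ, ∀ t', t ≤ t' →
      algebraMap ℚ_[p] (PadicAlgCl p) ((p : ℚ_[p]) ^ t') * (x i : PadicAlgCl p) ∈ padicCoeffIntegers S := by
    intro i
    obtain ⟨a, ha⟩ := ThetaTransport.StationR.exists_pow_smul_mem_padicCoeffIntegers S (x i)
    refine ⟨a, fun t' ht' ↦ ?_⟩
    have ha' : algebraMap ℚ_[p] (PadicAlgCl p) ((p : ℚ_[p]) ^ a) * (x i : PadicAlgCl p) ∈ padicCoeffIntegers S := by
      rw [IntermediateField.coe_smul, Algebra.smul_def] at ha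
      exact ha
    obtain ⟨d, rfl⟩ := Nat.exists_eq_add_of_le ht'
    have hpd : algebraMap ℚ_[p] (PadicAlgCl p) ((p : ℚ_[p]) ^ d) ∈ padicCoeffIntegers S := by
      rw [map_pow, map_natCast]
      exact pow_mem (natCast_mem _ p) d
    have := mul_mem hpd ha'
    rw [← mul_assoc, ← map_mul, ← pow_add, add_comm] at this
    exact this
  choose t ht using hone
  haveI := Fintype.ofFinite ι
  exact ⟨Finset.univ.sup t, fun i ↦ ht i _ (Finset.le_sup (Finset.mem_univ i))⟩

/-! ## §2 Frobenius coordinates -/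

section Frobenius

variable {S}
variable (t₀ : padicCoeffIntegers S →+ ℤ_[p])
  (ht₀ : ∀ (c : ℤ_[p]) (a : padicCoeffIntegers S), t₀ (padicIntToCoeffIntegers S c * a) = c * t₀ a)
  {nb : ℕ} (bO bO' : Fin nb → padicCoeffIntegers S)
  (hbO : ∀ a : padicCoeffIntegers S, a = ∑ j, padicIntToCoeffIntegers S (t₀ (a * bO' j)) * bO j)

include hbO in
/-- **Dual-basis expansion read in `ℚ̄_p`**: `φ = Σ_j t₀(φ bO′_j) · bO_j`. [cite: Lang2002, Ch. VI §5 Cor. 5.3] -/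
theorem coe_eq_sum_t₀_mul_bO (φ : padicCoeffIntegers S) :
    (φ : PadicAlgCl p) = ∑ j, algebraMap ℚ_[p] (PadicAlgCl p) (t₀ (φ * bO' j) : ℚ_[p]) * (bO j : PadicAlgCl p) := by
  conv_lhs => rw [hbO φ]
  push_cast
  refine Finset.sum_congr rfl fun j _ ↦ ?_
  rw [coe_padicIntToCoeffIntegers]

include ht₀ hbO in
/-- **`t₀(c φ) = Σ_j t₀(φ bO′_j) · t₀(c bO_j)`** (expand `φ` in the dual basis, `t₀` is `ℤ_p`-linear). [cite: Lang2002, Ch. VI §5 Cor. 5.3] -/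
theorem coe_t₀_mul_eq_sum (c φ : padicCoeffIntegers S) :
    ((t₀ (c * φ) : ℤ_[p]) : ℚ_[p]) = ∑ j, ((t₀ (φ * bO' j) : ℤ_[p]) : ℚ_[p]) * ((t₀ (c * bO j) : ℤ_[p]) : ℚ_[p]) := by
  have h : c * φ = ∑ j, padicIntToCoeffIntegers S (t₀ (φ * bO' j)) * (c * bO j) := by
    conv_lhs => rw [hbO φ]
    rw [Finset.mul_sum]
    refine Finset.sum_congr rfl fun j _ ↦ ?_
    ring
  rw [h, map_sum, PadicInt.coe_sum]
  refine Finset.sum_congr rfl fun j _ ↦ ?_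
  rw [ht₀, PadicInt.coe_mul]

include ht₀ hbO in
/-- **Frobenius coordinates of `ℚ_p`-linear functionals.** For a finite family `ℓ_i : ℚ̄_p →ₗ[ℚ_p] ℚ_p` there are ONE exponent `s` and elements
`c′_i ∈ 𝒪` with `t₀(c′_i a) = p^s ℓ_i(a)` for all `a ∈ 𝒪` (`c′_i = Σ_j p^s ℓ_i(bO_j) bO′_j`, `p^s` clearing the finitely many `ℓ_i(bO_j)`).
[cite: Lang2002, Ch. VI §5 Cor. 5.3] [cite: Kato2004Asterisque, Thm. 12.5 (1) (p. 221)] -/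
theorem exists_frobeniusCoords {n : ℕ} (ℓ : Fin n → (PadicAlgCl p →ₗ[ℚ_[p]] ℚ_[p])) :
    ∃ (s : ℕ) (c' : Fin n → padicCoeffIntegers S),
      ∀ (i : Fin n) (a : padicCoeffIntegers S), ((t₀ (c' i * a) : ℤ_[p]) : ℚ_[p]) = (p : ℚ_[p]) ^ s * ℓ i (a : PadicAlgCl p) := by
  obtain ⟨s, hs⟩ := exists_pow_forall_norm_mul_le_one (fun ij : Fin n × Fin nb ↦ ℓ ij.1 (bO ij.2 : PadicAlgCl p))
  -- the integral coefficients `λ_{ij} = p^s ℓ_i(bO_j)`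
  let lam : Fin n → Fin nb → ℤ_[p] := fun i j ↦ ⟨(p : ℚ_[p]) ^ s * ℓ i (bO j : PadicAlgCl p), hs (i, j)⟩
  have hlam : ∀ i j, ((lam i j : ℤ_[p]) : ℚ_[p]) = (p : ℚ_[p]) ^ s * ℓ i (bO j : PadicAlgCl p) := fun _ _ ↦ rfl
  refine ⟨s, fun i ↦ ∑ j, padicIntToCoeffIntegers S (lam i j) * bO' j, fun i a ↦ ?_⟩
  -- left: `t₀(c′_i a) = Σ_j λ_{ij} t₀(bO′_j a)`
  have hl : t₀ ((∑ j, padicIntToCoeffIntegers S (lam i j) * bO' j) * a) = ∑ j, lam i j * t₀ (bO' j * a) := by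
    rw [Finset.sum_mul, map_sum]
    refine Finset.sum_congr rfl fun j _ ↦ ?_
    rw [mul_assoc, ht₀]
  rw [hl, PadicInt.coe_sum]
  -- right: expand `a` in the dual basis and use `ℚ_p`-linearity of `ℓ_i`
  have hr : ℓ i (a : PadicAlgCl p) = ∑ j, ((t₀ (a * bO' j) : ℤ_[p]) : ℚ_[p]) * ℓ i (bO j : PadicAlgCl p) := by
    conv_lhs => rw [coe_eq_sum_t₀_mul_bO t₀ bO bO' hbO a]
    rw [map_sum]
    refine Finset.sum_congr rfl fun j _ ↦ ?_
    rw [← Algebra.smul_def, map_smul, smul_eq_mul]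
  rw [hr, Finset.mul_sum]
  refine Finset.sum_congr rfl fun j _ ↦ ?_
  rw [PadicInt.coe_mul, hlam, mul_comm (bO' j) a]
  ring

/-- **The coordinates separate `𝒪` when the functionals do**: if `a ↦ (ℓ_i(a))_i` is injective on `𝒪` and `t₀(c′_i a) = p^s ℓ_i(a)`, then
`a ↦ (t₀(c′_i a))_i` is injective (the consumer's `CoordNondeg c′`). [cite: Kato2004Asterisque, §14.9 (p. 239)] -/
theorem injective_t₀Coords_of_injective {n : ℕ} (ℓ : Fin n → (PadicAlgCl p →ₗ[ℚ_[p]] ℚ_[p]))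
    (hND : Function.Injective (fun (a : padicCoeffIntegers S) (i : Fin n) ↦ ℓ i (a : PadicAlgCl p)))
    (s : ℕ) (c' : Fin n → padicCoeffIntegers S)
    (hc' : ∀ (i : Fin n) (a : padicCoeffIntegers S), ((t₀ (c' i * a) : ℤ_[p]) : ℚ_[p]) = (p : ℚ_[p]) ^ s * ℓ i (a : PadicAlgCl p)) :
    Function.Injective (fun (a : padicCoeffIntegers S) (i : Fin n) ↦ t₀ (c' i * a)) := by
  intro a b hab
  apply hND
  funext i
  have h := congr_fun hab i
  have h' : ((t₀ (c' i * a) : ℤ_[p]) : ℚ_[p]) = ((t₀ (c' i * b) : ℤ_[p]) : ℚ_[p]) := by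
    simp only at h
    rw [h]
  rw [hc', hc'] at h'
  have hp0 : (p : ℚ_[p]) ^ s ≠ 0 := pow_ne_zero _ (Nat.cast_ne_zero.mpr (Fact.out : p.Prime).ne_zero)
  exact mul_left_cancel₀ hp0 h'

end Frobenius

/-! ## §3 Galois sums with `ℚ_p`-rational coefficients -/

/-- **Galois sums with `ℚ_p`-rational coefficients**: `Σ_b τ_b • (x · Σ_k d_k y_k) = Σ_k d_k · Σ_b τ_b • (x · y_k)` for `d_k ∈ ℚ_p`
(`τ_b ∈ Γ_{ℚ_p}` act by ring automorphisms fixing `ℚ_p`). [folklore] -/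
theorem sum_smul_mul_sum_algebraMap_mul {B K : Type*} [Fintype B] [Fintype K] (τ : B → Field.absoluteGaloisGroup ℚ_[p])
    (x : PadicAlgCl p) (d : K → ℚ_[p]) (y : K → PadicAlgCl p) :
    ∑ b, τ b • (x * ∑ k, algebraMap ℚ_[p] (PadicAlgCl p) (d k) * y k) =
      ∑ k, algebraMap ℚ_[p] (PadicAlgCl p) (d k) * ∑ b, τ b • (x * y k) := by
  simp only [Finset.mul_sum, Finset.smul_sum, smul_mul', SignedKatoOffTwo.FrameChange.gal_smul_algebraMap]
  rw [Finset.sum_comm]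
  refine Finset.sum_congr rfl fun k _ ↦ Finset.sum_congr rfl fun b _ ↦ ?_
  ring

/-- `τ • (c · y) = c · (τ • y)` for `c ∈ ℚ_p`. [folklore] -/
theorem gal_smul_algebraMap_mul (σ : Field.absoluteGaloisGroup ℚ_[p]) (c : ℚ_[p]) (y : PadicAlgCl p) :
    σ • (algebraMap ℚ_[p] (PadicAlgCl p) c * y) = algebraMap ℚ_[p] (PadicAlgCl p) c * σ • y := by
  rw [smul_mul', SignedKatoOffTwo.FrameChange.gal_smul_algebraMap]

end Summit.BirchSwinnertonDyer.BirchSwinnertonDyer.Theorems.ThetaTransport.ChildA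

end
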